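import Summits.Ventures.DiscreteObjects.Hadamard.Order167CentralizerFree668
import Summits.Ventures.DiscreteObjects.Hadamard.AutomorphismFixedRows668

/-!
# H(668): involutions commuting with an element of order 83 fix 0, 4 or 332 rows; with an element of order 37 they fix
# 0, 76 or 148 rows — windows for the element orders 166 and 74 (kernel)

Framing: lottery ticket; floor = certified bounds/negative ranges.

Cell pub-namedobj (venture DiscreteObjects), target (H), hadamard gen 21 (HANDOFF-H-g19 item 4, by the 'commuting involution'
method of `Order666Excluded668`, sharpened by the mod-8 involution census).  Let `H` be a Hadamard matrix of order `668`.
* Tools: for a permutation `ψ` commuting with `π` (`π ^ p = 1`, `p` prime) the `ψ`-fixed `π`-moved points form a union of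
  `π`-orbits, so `p ∣ #{x | ψ x = x, π x ≠ x}` (`dvd_card_fixed_moved_of_commute`); if `ψ² = 1` the `ψ`-fixed `π`-fixed points
  have the parity of `#Fix π` (`card_fixed_fixed_mod_two`).  Hence `#Fix ψ = f₀ + p·m` with `f₀ ≡ #Fix π (mod 2)`, `f₀ ≤ #Fix π`.
* **`hadamard668_order83_centralizing_involution`**: `σ = (π, κ, d, e)` a signed automorphism with `π^83 = κ^83 = 1`,
  `(π, κ) ≠ (1,1)` (gen 5: `4 + 4` fixed, `8 + 8` orbits) and `τ = (π', κ', d', e')` a signed automorphism with `π'² = κ'² = 1`,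
  `(π', κ') ≠ (1,1)`, `π'π = ππ'`: **`#Fix π' = #Fix κ' ∈ {0, 4, 332}`** [census (gen 13): `f ≡ 4 (mod 8)`, `4 ≤ f ≤ 332`, or
  `f = 0`; `f = f₀ + 83 m` with `f₀ ∈ {0, 2, 4}` leaves `4 = 4 + 0` and `332 = 0 + 4·83`].  So a centralising involution is
  nega (no fixed point), or fixes exactly the four `σ`-fixed rows and permutes the eight orbits freely, or fixes four whole
  orbits and no `σ`-fixed row.
* **`hadamard668_order37_centralizing_involution`**: the same with `π^37 = κ^37 = 1` (gen 5: `2 + 2` fixed, `18 + 18` orbits):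
  **`#Fix π' = #Fix κ' ∈ {0, 76, 148}`** (`76 = 2 + 2·37`, `148 = 4·37`).
* **`hadamard668_order166_pow83_fixed`**, **`hadamard668_order74_pow37_fixed`**: for a signed automorphism of pair order `166`
  (resp. `74`) the involution `g^83` (resp. `g^37`) fixes `0, 4` or `332` (resp. `0, 76` or `148`) rows, as many columns.
WINDOWS (structure) only: neither order `166` nor `74` is excluded; H(668) untouched; HITS 0/4.  Ours; no `sorry`, no
definitions, default heartbeats.
-/

namespace Summit.Ventures.DiscreteObjects.Hadamard

open Finset BigOperators Matrix

open Literature.Combinatorics.Designs.GoethalsSeidel (IsHadamardMatrix)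

variable {ι : Type*} [Fintype ι] [DecidableEq ι]

/-! ### counting tools for a permutation commuting with `π` -/

/-- the `ψ`-fixed, `π`-moved points form a union of `π`-orbits: `p ∣ #{x | ψ x = x ∧ π x ≠ x}` -/
lemma dvd_card_fixed_moved_of_commute {π ψ : Equiv.Perm ι} (hc : Commute ψ π) {p : ℕ} (hp : p.Prime) (hπ : π ^ p = 1) :
    p ∣ (univ.filter fun x => ψ x = x ∧ π x ≠ x).card := by
  have h1 : ∀ x, ψ (π x) = π (ψ x) := fun x => by
    rw [← Equiv.Perm.mul_apply, hc.eq, Equiv.Perm.mul_apply]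
  have hstab : ∀ x, (ψ (π x) = π x ∧ π (π x) ≠ π x) ↔ (ψ x = x ∧ π x ≠ x) := by
    intro x
    rw [h1, π.injective.eq_iff, π.injective.ne_iff]
  set ρ : Equiv.Perm {x // ψ x = x ∧ π x ≠ x} := π.subtypePerm hstab with hρ
  have hρp : ρ ^ p = 1 := by
    rw [hρ, Equiv.Perm.subtypePerm_pow]
    ext ⟨x, hx⟩
    change (π ^ p) x = x
    rw [hπ, Equiv.Perm.one_apply]
  have hρfix : (univ.filter fun y : {x // ψ x = x ∧ π x ≠ x} => ρ y = y).card = 0 := by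
    rw [Finset.card_eq_zero, Finset.filter_eq_empty_iff]
    rintro ⟨x, hx⟩ - h
    apply hx.2
    have h' := congrArg Subtype.val h
    simpa [hρ] using h'
  have hcl := card_fixed_add_classes ρ hp hρp
  rw [hρfix, zero_add, Fintype.card_subtype] at hcl
  exact ⟨_, by rw [← hcl, mul_comm]⟩

/-- splitting the fixed points of `ψ` by `π`-fixedness -/
lemma card_fixed_split (π ψ : Equiv.Perm ι) :
    (univ.filter fun x => ψ x = x).card =
      (univ.filter fun x => ψ x = x ∧ π x = x).card + (univ.filter fun x => ψ x = x ∧ π x ≠ x).card := by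
  rw [← Finset.filter_filter, ← Finset.filter_filter,
    Finset.card_filter_add_card_filter_not (fun x => π x = x)]

/-- for an involution `ψ` commuting with `π`: the `ψ`-fixed `π`-fixed points have the parity of `#Fix π`, and are at most
that many -/
lemma card_fixed_fixed_mod_two {π ψ : Equiv.Perm ι} (hc : Commute ψ π) (hψ : ψ ^ 2 = 1) :
    ∃ k : ℕ, (univ.filter fun x => ψ x = x ∧ π x = x).card + 2 * k = (univ.filter fun x => π x = x).card := by
  have h1 : ∀ x, π (ψ x) = ψ (π x) := fun x => by
    rw [← Equiv.Perm.mul_apply, ← hc.eq, Equiv.Perm.mul_apply]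
  have hstab : ∀ x, π (ψ x) = ψ x ↔ π x = x := by
    intro x; rw [h1, ψ.injective.eq_iff]
  set ρ : Equiv.Perm {x // π x = x} := ψ.subtypePerm hstab with hρ
  have hρ2 : ρ ^ 2 = 1 := by
    rw [hρ, Equiv.Perm.subtypePerm_pow]
    ext ⟨x, hx⟩
    change (ψ ^ 2) x = x
    rw [hψ, Equiv.Perm.one_apply]
  have hcl := card_fixed_add_classes ρ Nat.prime_two hρ2
  rw [Fintype.card_subtype] at hcl
  refine ⟨(blockClasses ρ 2).card, ?_⟩
  rw [← hcl, mul_comm]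
  congr 1
  -- the fixed points of ρ are the ψ-fixed π-fixed points
  rw [← Fintype.card_subtype, ← Fintype.card_subtype]
  refine Fintype.card_congr ((Equiv.subtypeEquivRight fun x => And.comm).trans
    ((Equiv.subtypeSubtypeEquivSubtypeInter (fun x => π x = x) (fun x => ψ x = x)).symm.trans
      (Equiv.subtypeEquivRight fun y => ?_)))
  rw [hρ, Subtype.ext_iff, Equiv.Perm.subtypePerm_apply]

/-! ### involutions centralising an element of order 83 or 37 -/

section main
variable {H : Matrix ι ι ℤ} (hH : IsHadamardMatrix H) (hι : Fintype.card ι = 668)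
  {π κ π' κ' : Equiv.Perm ι} {d e d' e' : ι → ℤ} (haut : IsSignedAut H π κ d e)
  (haut' : IsSignedAut H π' κ' d' e') (hcπ : Commute π' π) (h2 : π' ^ 2 = 1) (h2' : κ' ^ 2 = 1)
  (hne' : π' ≠ 1 ∨ κ' ≠ 1)
include hH hι haut haut' hcπ h2 h2' hne'

omit haut in
/-- generic step: if `π ^ p = 1` (`p` prime), a commuting involution fixes `f₀ + p·m` rows with `f₀ + 2k = #Fix π`, and the
involution census applies -/
lemma centralizing_involution_count {p : ℕ} (hp : p.Prime) (hπ : π ^ p = 1) :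
    ∃ f₀ m k : ℕ, f₀ + 2 * k = (univ.filter fun x => π x = x).card ∧
      (univ.filter fun x => π' x = x).card = f₀ + p * m ∧
      (((univ.filter fun x => π' x = x).card = (univ.filter fun y => κ' y = y).card ∧
        (univ.filter fun x => π' x = x).card % 8 = 4 ∧ 4 ≤ (univ.filter fun x => π' x = x).card ∧
        (univ.filter fun x => π' x = x).card ≤ 332) ∨
       ((univ.filter fun x => π' x = x).card = 0 ∧ (univ.filter fun y => κ' y = y).card = 0)) := by
  obtain ⟨k, hk⟩ := card_fixed_fixed_mod_two hcπ h2
  obtain ⟨m, hm⟩ := dvd_card_fixed_moved_of_commute hcπ hp hπ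
  refine ⟨_, m, k, hk, ?_, ?_⟩
  · rw [card_fixed_split π π', hm]
  · obtain ⟨-, -, hcases⟩ := hadamard668_involution_census_final hH hι π' κ' d' e' haut' h2 h2' hne'
    rcases hcases with ⟨heq, hmod8, h4, h332, -⟩ | ⟨h0, h0', -, -⟩
    · exact Or.inl ⟨heq, hmod8, h4, h332⟩
    · exact Or.inr ⟨h0, h0'⟩

/-- **Involutions centralising an element of order 83 fix `0`, `4` or `332` rows (and as many columns).** -/
theorem hadamard668_order83_centralizing_involution (hπ : π ^ 83 = 1) (hκ : κ ^ 83 = 1) (hne : π ≠ 1 ∨ κ ≠ 1) :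
    (univ.filter fun x => π' x = x).card = (univ.filter fun y => κ' y = y).card ∧
    ((univ.filter fun x => π' x = x).card = 0 ∨ (univ.filter fun x => π' x = x).card = 4 ∨
      (univ.filter fun x => π' x = x).card = 332) := by
  have hf := (hadamard668_fixedRows_83 hH hι π κ d e haut hπ hκ hne).1
  obtain ⟨f₀, m, k, hk, hcount, hcases⟩ := centralizing_involution_count hH hι haut' hcπ h2 h2' hne' (by norm_num) hπ
  rw [hf] at hk
  rcases hcases with ⟨heq, hmod8, h4, h332⟩ | ⟨h0, h0'⟩
  · refine ⟨heq, Or.inr ?_⟩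
    rw [hcount] at hmod8 h4 h332 ⊢
    have hm : m ≤ 4 := by omega
    interval_cases m <;> omega
  · exact ⟨by rw [h0, h0'], Or.inl h0⟩

/-- **Involutions centralising an element of order 37 fix `0`, `76` or `148` rows (and as many columns).** -/
theorem hadamard668_order37_centralizing_involution (hπ : π ^ 37 = 1) (hκ : κ ^ 37 = 1) (hne : π ≠ 1 ∨ κ ≠ 1) :
    (univ.filter fun x => π' x = x).card = (univ.filter fun y => κ' y = y).card ∧
    ((univ.filter fun x => π' x = x).card = 0 ∨ (univ.filter fun x => π' x = x).card = 76 ∨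
      (univ.filter fun x => π' x = x).card = 148) := by
  have hf := (hadamard668_fixedRows_37 hH hι π κ d e haut hπ hκ hne).1
  obtain ⟨f₀, m, k, hk, hcount, hcases⟩ := centralizing_involution_count hH hι haut' hcπ h2 h2' hne' (by norm_num) hπ
  rw [hf] at hk
  rcases hcases with ⟨heq, hmod8, h4, h332⟩ | ⟨h0, h0'⟩
  · refine ⟨heq, Or.inr ?_⟩
    rw [hcount] at hmod8 h4 h332 ⊢
    have hm : m ≤ 8 := by omega
    interval_cases m <;> omega
  · exact ⟨by rw [h0, h0'], Or.inl h0⟩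

end main

/-! ### windows for the element orders 166 and 74 -/

section windows
variable {H : Matrix ι ι ℤ} (hH : IsHadamardMatrix H) (hι : Fintype.card ι = 668)
  {π κ : Equiv.Perm ι} {d e : ι → ℤ} (haut : IsSignedAut H π κ d e)
include hH hι haut

/-- **Order 166: the involution `g^83` fixes `0`, `4` or `332` rows, and as many columns.** -/
theorem hadamard668_order166_pow83_fixed (hπ : π ^ 166 = 1) (hκ : κ ^ 166 = 1) (h83 : π ^ 83 ≠ 1 ∨ κ ^ 83 ≠ 1)
    (h2 : π ^ 2 ≠ 1 ∨ κ ^ 2 ≠ 1) :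
    (univ.filter fun x => (π ^ 83) x = x).card = (univ.filter fun y => (κ ^ 83) y = y).card ∧
    ((univ.filter fun x => (π ^ 83) x = x).card = 0 ∨ (univ.filter fun x => (π ^ 83) x = x).card = 4 ∨
      (univ.filter fun x => (π ^ 83) x = x).card = 332) := by
  have hσπ : (π ^ 2) ^ 83 = 1 := by rw [← pow_mul]; exact hπ
  have hσκ : (κ ^ 2) ^ 83 = 1 := by rw [← pow_mul]; exact hκ
  have hιπ : (π ^ 83) ^ 2 = 1 := by rw [← pow_mul]; exact hπ
  have hικ : (κ ^ 83) ^ 2 = 1 := by rw [← pow_mul]; exact hκ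
  exact hadamard668_order83_centralizing_involution hH hι (isSignedAut_pow haut 2) (isSignedAut_pow haut 83)
    ((Commute.refl π).pow_pow 83 2) hιπ hικ h83 hσπ hσκ h2

/-- **Order 74: the involution `g^37` fixes `0`, `76` or `148` rows, and as many columns.** -/
theorem hadamard668_order74_pow37_fixed (hπ : π ^ 74 = 1) (hκ : κ ^ 74 = 1) (h37 : π ^ 37 ≠ 1 ∨ κ ^ 37 ≠ 1)
    (h2 : π ^ 2 ≠ 1 ∨ κ ^ 2 ≠ 1) :
    (univ.filter fun x => (π ^ 37) x = x).card = (univ.filter fun y => (κ ^ 37) y = y).card ∧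
    ((univ.filter fun x => (π ^ 37) x = x).card = 0 ∨ (univ.filter fun x => (π ^ 37) x = x).card = 76 ∨
      (univ.filter fun x => (π ^ 37) x = x).card = 148) := by
  have hσπ : (π ^ 2) ^ 37 = 1 := by rw [← pow_mul]; exact hπ
  have hσκ : (κ ^ 2) ^ 37 = 1 := by rw [← pow_mul]; exact hκ
  have hιπ : (π ^ 37) ^ 2 = 1 := by rw [← pow_mul]; exact hπ
  have hικ : (κ ^ 37) ^ 2 = 1 := by rw [← pow_mul]; exact hκ
  exact hadamard668_order37_centralizing_involution hH hι (isSignedAut_pow haut 2) (isSignedAut_pow haut 37)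
    ((Commute.refl π).pow_pow 37 2) hιπ hικ h37 hσπ hσκ h2

/-- order form: `orderOf (π, κ) = 166 ⇒ #Fix π^83 ∈ {0, 4, 332}` -/
theorem hadamard668_orderOf_166_pow83_fixed (h : orderOf ((π, κ) : Equiv.Perm ι × Equiv.Perm ι) = 166) :
    (univ.filter fun x => (π ^ 83) x = x).card = 0 ∨ (univ.filter fun x => (π ^ 83) x = x).card = 4 ∨
      (univ.filter fun x => (π ^ 83) x = x).card = 332 := by
  obtain ⟨hπ, hκ, h83⟩ := pow_data_of_orderOf h (a := 83) (by norm_num) (by norm_num)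
  obtain ⟨-, -, h2⟩ := pow_data_of_orderOf h (a := 2) (by norm_num) (by norm_num)
  exact (hadamard668_order166_pow83_fixed hH hι haut hπ hκ h83 h2).2

/-- order form: `orderOf (π, κ) = 74 ⇒ #Fix π^37 ∈ {0, 76, 148}` -/
theorem hadamard668_orderOf_74_pow37_fixed (h : orderOf ((π, κ) : Equiv.Perm ι × Equiv.Perm ι) = 74) :
    (univ.filter fun x => (π ^ 37) x = x).card = 0 ∨ (univ.filter fun x => (π ^ 37) x = x).card = 76 ∨
      (univ.filter fun x => (π ^ 37) x = x).card = 148 := by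
  obtain ⟨hπ, hκ, h37⟩ := pow_data_of_orderOf h (a := 37) (by norm_num) (by norm_num)
  obtain ⟨-, -, h2⟩ := pow_data_of_orderOf h (a := 2) (by norm_num) (by norm_num)
  exact (hadamard668_order74_pow37_fixed hH hι haut hπ hκ h37 h2).2

end windows

end Summit.Ventures.DiscreteObjects.Hadamard
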